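import Literature.MathematicalPhysics.QuantumFieldTheory.Balaban1983to89.B1Eq324BenfattoKernelSect5Iteration
import Literature.MathematicalPhysics.QuantumFieldTheory.Balaban1983to89.B1Eq324BenfattoSect5PavementChain
import Literature.MathematicalPhysics.QuantumFieldTheory.Balaban1983to89.B1Eq324BenfattoKernelSect5ClassRows
import HarnessLib

/-!
# `Balaban1983to89.B1Eq324BenfattoKernelSect5ChainGeometry` — [BenfattoEtAl1978] §5 p. 154 «we can arrange the pavements», p. 159 «choosing a new pavement
# displaced», Lemma p. 152 «C … at distance b³ from J», FOR A FINITE WINDOW `Λ`: the ADMISSIBILITY half of the per-instance class sandwich — the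
# containment and far-conditioning binders of BOTH class knits discharged from TWO original-frame hypotheses (finite-set geometry only)

statement-level skeleton of published theorems with citation tags; proofs where landed; nothing here is a claim about the
Yang–Mills mass gap

WHY THIS MODULE (cell `pub-ymgap`, seat `dag-n08-c` gen 32, CLAIM-19; node N08 [Balaban1985UV3]; the [BenfattoEtAl1978] source chain behind the (α)-row
`h324`).  The class knits `…KernelSect5LowerAssembly.exp_cumulantSum_sub_le_integral_of_ledger` ((4.7); n08-b's `…LowerAssemblyStop` at the stopping index)
and `…KernelSect5UpperAssembly.integral_condFieldK_le_exp_cumulantSum_add_of_ledger` ((4.6)) run n08-d's displaced chains inside a FINITE window `Λ`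
(the class member's index set) and therefore DISPLAY, per step `k`, that the pavement of `B_k = (J_k + τ_k).image boxIndex` and its corridors lie in the
frame `Λ − σ_{k+1}` (`hBΛ`, `hΓΛ`), and — on the (4.6) side — that the translated conditioning set `C_k + τ_k` lies there (`hCΛ`), misses the parts
(`hCsh`) and is `|·−·|₂`-far from the boxes (`hCfar`).  Print works on all of `ℤ^d` (no window); for the per-instance sandwich that n08-d's measure-free
adapter `…Eq324Signed.eq324_of_sandwich_consts` (v1.1) consumes, these five binders must be discharged from admissibility conditions stated ONCE, in the
ORIGINAL frame, on `(Λ, J_0, C_0)`.  This file does exactly that, for ANY chain obeying n08-d's recursions (`J_{k+1} = (J_k + τ_k) ∩ Γ̄₁(B_k)`,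
`C_{k+1} = C_k + τ_k`, `σ_0 = 0`, `σ_{k+1} = σ_k − τ_k`) at a general number of steps: read back in the original frame the drifting supports stay inside
`J_0` (`J_k + σ_k ⊆ J_0`) and the conditioning sets are `C_0 − σ_k`; so ONE padding hypothesis «the open sup-`L`-thickening of `J_0` lies in `Λ`» gives
`hBΛ`/`hΓΛ` at every step, `C_0 ⊆ Λ` gives `hCΛ`, and ONE Euclidean far hypothesis «`|x − c|₂ ≥ R + √d·L` for `x ∈ J_0`, `c ∈ C_0`» (`R > 0`) gives
`hCsh`/`hCfar` at every step.  The separation binder `hsep` of `chain_eq_empty_of_sep` / `exists_stoppingIndex` for the constant diagonal displacements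
`τ_k ≡ −c·𝟙` is `…Sect5PavementChain.sep_of_diagonalShifts` after the cumulative-sum bookkeeping, recorded as a lemma (it was inlined in my concrete
`…Sect5LowerAssembly.ineq47_of_ledger`).

WHAT IS PROVED (theorems only; no definition, no named fact, no `sorry`; axioms standard; NO measure theory).
* §1 `image_add_sigma_mem` (`J_k + σ_k ⊆ J_0`), `conditioning_eq_image_sub_sigma` (`C_k = C_0 − σ_k`), `sigma_eq_neg_sum` (`σ_k = −Σ_{i<k}τ_i`).
* §2 ★★ `boxes_subset_frame_of_pad`, `corridors_subset_frame_of_pad` — the knits' `hBΛ`, `hΓΛ` from the padding of `J_0` in `Λ`.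
* §3 ★ `conditioning_subset_frame` — S8b's `hCΛ` from `C_0 ⊆ Λ`; ★★ `disjoint_shrink_conditioning_of_far`, `far_conditioning_of_far` — the (4.6) knit's
  `hCsh`, `hCfar` from the original-frame Euclidean far hypothesis; helper `l2_le_sqrt_mul_of_abs_lt` (`|·|₂ ≤ √d·L` inside one tessera).
* §4 `sep_of_constDiagonal` — `hsep` for `τ_k ≡ −c·𝟙` when `(d+1)·c ≤ L`.

HONEST SCOPE / NOT HERE.  Finite-set geometry of the displaced pavements inside a window; the ledger conversion (`…LedgerBridge`, seat n08-b), the packs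
and the per-instance sandwich theorems themselves are separate modules; the class is OURS; one self-located piece of an UNCOMMISSIONED port; nothing of
[Balaban1985UV3] is asserted; count-neutral for N08; nothing about d = 4, the continuum, OS axioms, a mass gap or the Clay problem.
-/

open Finset
open scoped BigOperators

namespace Literature.MathematicalPhysics.QuantumFieldTheory.Balaban1983to89.B1Eq324BenfattoKernelSect5ChainGeometry

open Literature.MathematicalPhysics.QuantumFieldTheory.Balaban1983to89.B1Eq324BenfattoLemma
open Literature.MathematicalPhysics.QuantumFieldTheory.Balaban1983to89.B1Eq324BenfattoSect5Boxes
open Literature.MathematicalPhysics.QuantumFieldTheory.Balaban1983to89.B1Eq324BenfattoSect5Eq534 (corridorsBar)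
open Literature.MathematicalPhysics.QuantumFieldTheory.Balaban1983to89.B1Eq324BenfattoKernelSect5Iteration (mem_image_sub_iff)
open Literature.MathematicalPhysics.QuantumFieldTheory.Balaban1983to89.B1Eq324BenfattoSect5PavementChain (sep_of_diagonalShifts)
open Literature.MathematicalPhysics.QuantumFieldTheory.Balaban1983to89.B1Eq324BenfattoKernelSect5ClassRows (l2_comm l2_triangle)

variable {d : ℕ}

/-! ## §1  The drifting chain read back in the original frame -/

section OriginalFrame

variable {L w v : ℕ} {Js Bs Cs : ℕ → Finset (B1Eq324BenfattoLemma.Site d)} {τ σ : ℕ → B1Eq324BenfattoLemma.Site d} {n : ℕ}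

/-- **The kernel offsets are the negated cumulative displacements**: `σ_0 = 0`, `σ_{k+1} = σ_k − τ_k` give `σ_k = −Σ_{i<k} τ_i` (`k ≤ n`).
[cite: BenfattoEtAl1978, §5 p.159 «a new pavement displaced» (class form; ours)] -/
theorem sigma_eq_neg_sum (hσ0 : σ 0 = 0) (hrecσ : ∀ k < n, σ (k + 1) = σ k - τ k) :
    ∀ k ≤ n, σ k = -(∑ i ∈ Finset.range k, τ i) := by
  intro k
  induction k with
  | zero => intro _; rw [hσ0, Finset.range_zero, Finset.sum_empty, neg_zero]
  | succ k ih =>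
    intro hk
    have hk' : k < n := Nat.lt_of_succ_le hk
    rw [hrecσ k hk', ih hk'.le, Finset.sum_range_succ, neg_add]
    abel

/-- **The drifting supports stay inside `J_0` in the original frame**: along `J_{k+1} = (J_k + τ_k) ∩ Γ̄₁(B_k)`, `σ_{k+1} = σ_k − τ_k`, every `x ∈ J_k`
has `x + σ_k ∈ J_0` (`k ≤ n`).  [cite: BenfattoEtAl1978, §5 p.159 «a new pavement displaced», (5.34) (class form; ours)] -/
theorem image_add_sigma_mem
    (hrecJ : ∀ k < n, Js (k + 1) = (Js k).image (fun x => x + τ k) ∩ corridorsBar L w v (Bs k))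
    (hσ0 : σ 0 = 0) (hrecσ : ∀ k < n, σ (k + 1) = σ k - τ k) :
    ∀ k ≤ n, ∀ x ∈ Js k, x + σ k ∈ Js 0 := by
  intro k
  induction k with
  | zero => intro _ x hx; rwa [hσ0, add_zero]
  | succ k ih =>
    intro hk x hx
    have hk' : k < n := Nat.lt_of_succ_le hk
    rw [hrecJ k hk'] at hx
    obtain ⟨y, hy, rfl⟩ := Finset.mem_image.mp (Finset.mem_inter.mp hx).1
    have h := ih hk'.le y hy
    rw [hrecσ k hk']
    have e : y + τ k + (σ k - τ k) = y + σ k := by abel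
    rwa [e]

/-- **The drifting conditioning sets are `C_0` read in the frame**: along `C_{k+1} = C_k + τ_k`, `C_k = C_0 − σ_k` (`k ≤ n`).
[cite: BenfattoEtAl1978, Lemma p.152 «P̂₀(dz|(z̄_Δ)_{Δ∈C})», §5 p.159 (class form; ours)] -/
theorem conditioning_eq_image_sub_sigma
    (hrecC : ∀ k < n, Cs (k + 1) = (Cs k).image fun x => x + τ k)
    (hσ0 : σ 0 = 0) (hrecσ : ∀ k < n, σ (k + 1) = σ k - τ k) :
    ∀ k ≤ n, Cs k = (Cs 0).image fun x => x - σ k := by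
  intro k
  induction k with
  | zero =>
    intro _
    rw [hσ0]
    ext x
    simp
  | succ k ih =>
    intro hk
    have hk' : k < n := Nat.lt_of_succ_le hk
    rw [hrecC k hk', ih hk'.le, Finset.image_image, hrecσ k hk']
    congr 1
    funext x
    show x - σ k + τ k = x - (σ k - τ k)
    abel

/-- The translated conditioning set of step `k` is `C_0 − σ_{k+1}` (`k < n`). [cite: BenfattoEtAl1978, §5 p.159 (class form; ours)] -/
theorem conditioning_image_add_eq
    (hrecC : ∀ k < n, Cs (k + 1) = (Cs k).image fun x => x + τ k)
    (hσ0 : σ 0 = 0) (hrecσ : ∀ k < n, σ (k + 1) = σ k - τ k) :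
    ∀ k < n, (Cs k).image (fun x => x + τ k) = (Cs 0).image fun x => x - σ (k + 1) := by
  intro k hk
  rw [← hrecC k hk]
  exact conditioning_eq_image_sub_sigma hrecC hσ0 hrecσ (k + 1) hk

end OriginalFrame

/-! ## §2  The pavements inside the frames, from the padding of `J_0` in `Λ` -/

section Padding

variable {L w v : ℕ} {Λ : Finset (B1Eq324BenfattoLemma.Site d)} {Js Bs : ℕ → Finset (B1Eq324BenfattoLemma.Site d)}
  {τ σ : ℕ → B1Eq324BenfattoLemma.Site d} {n : ℕ}

/-- ★★ **THE PAVEMENTS LIE IN THE FRAMES** — if the open sup-`L`-thickening of `J_0` lies in `Λ` (`∀ x ∈ J_0, ∀ z, (∀ i, |z_i − x_i| < L) → z ∈ Λ`), then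
at every step `k < n` every tessera of `B_k = (J_k + τ_k).image boxIndex` lies in the frame `Λ − σ_{k+1}`: the knits' binder `hBΛ`.  (A tessera of `B_k`
contains a point of `J_k + τ_k`, which read back in the original frame is a point of `J_0` by `image_add_sigma_mem`; tesserae have sup-diameter `< L`.)
[cite: BenfattoEtAl1978, §5 (5.7) p.154, p.159 «a new pavement displaced» (class form; ours)] -/
theorem boxes_subset_frame_of_pad (hL : 0 < L)
    (hrecJ : ∀ k < n, Js (k + 1) = (Js k).image (fun x => x + τ k) ∩ corridorsBar L w v (Bs k))
    (hσ0 : σ 0 = 0) (hrecσ : ∀ k < n, σ (k + 1) = σ k - τ k)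
    (hpad : ∀ x ∈ Js 0, ∀ z : B1Eq324BenfattoLemma.Site d, (∀ i, |z i - x i| < (L : ℤ)) → z ∈ Λ) :
    ∀ k, k < n → ∀ m ∈ ((Js k).image fun x => x + τ k).image (boxIndex L), box L m ⊆ Λ.image fun y => y - σ (k + 1) := by
  intro k hk m hm z hz
  refine (mem_image_sub_iff (σ (k + 1))).mpr ?_
  obtain ⟨p, hp, rfl⟩ := Finset.mem_image.mp hm
  obtain ⟨y, hy, rfl⟩ := Finset.mem_image.mp hp
  have hyJ : y + σ k ∈ Js 0 := image_add_sigma_mem hrecJ hσ0 hrecσ k hk.le y hy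
  refine hpad (y + σ k) hyJ (z + σ (k + 1)) fun i => ?_
  have hz' := (mem_box_iff.mp hz) i
  have hy' := (mem_box_iff.mp (mem_box_boxIndex hL (y + τ k))) i
  rw [hrecσ k hk]
  simp only [Pi.add_apply, Pi.sub_apply] at hz' hy' ⊢
  rw [abs_lt]
  constructor <;> linarith

/-- **THE CORRIDORS LIE IN THE FRAMES** — the same for `Γ₁(B_k) ⊆ ⋃_{□∈B_k} □`: the knits' binder `hΓΛ`.
[cite: BenfattoEtAl1978, §5 (5.8) p.155, p.159 (class form; ours)] -/
theorem corridors_subset_frame_of_pad (hL : 0 < L)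
    (hrecJ : ∀ k < n, Js (k + 1) = (Js k).image (fun x => x + τ k) ∩ corridorsBar L w v (Bs k))
    (hσ0 : σ 0 = 0) (hrecσ : ∀ k < n, σ (k + 1) = σ k - τ k)
    (hpad : ∀ x ∈ Js 0, ∀ z : B1Eq324BenfattoLemma.Site d, (∀ i, |z i - x i| < (L : ℤ)) → z ∈ Λ) :
    ∀ k < n, corridors L w (((Js k).image fun x => x + τ k).image (boxIndex L)) ⊆ Λ.image fun y => y - σ (k + 1) := by
  intro k hk z hz
  rw [corridors, Finset.mem_biUnion] at hz
  obtain ⟨m, hm, hzm⟩ := hz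
  rw [frame1] at hzm
  exact boxes_subset_frame_of_pad hL hrecJ hσ0 hrecσ hpad k hk m hm (Finset.mem_sdiff.mp hzm).1

end Padding

/-! ## §3  The conditioning sets inside the frames, off the parts and far from the boxes -/

section Conditioning

variable {L w v : ℕ} {Λ : Finset (B1Eq324BenfattoLemma.Site d)} {Js Bs Cs : ℕ → Finset (B1Eq324BenfattoLemma.Site d)}
  {τ σ : ℕ → B1Eq324BenfattoLemma.Site d} {n : ℕ}

/-- ★ **THE CONDITIONING SETS LIE IN THE FRAMES** — `C_0 ⊆ Λ` gives S8b's binder `hCΛ : C_k + τ_k ⊆ Λ − σ_{k+1}` at every step (`C_k + τ_k = C_0 − σ_{k+1}`).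
[cite: BenfattoEtAl1978, Lemma p.152, §5 p.159 (class form; ours)] -/
theorem conditioning_subset_frame
    (hrecC : ∀ k < n, Cs (k + 1) = (Cs k).image fun x => x + τ k)
    (hσ0 : σ 0 = 0) (hrecσ : ∀ k < n, σ (k + 1) = σ k - τ k) (hC0 : Cs 0 ⊆ Λ) :
    ∀ k < n, (Cs k).image (fun x => x + τ k) ⊆ Λ.image fun y => y - σ (k + 1) := by
  intro k hk
  rw [conditioning_image_add_eq hrecC hσ0 hrecσ k hk]
  exact Finset.image_subset_image hC0

/-- **Inside one tessera the Euclidean distance is `< √d·L`... precisely: if every coordinate of `x − z` is `< L` in absolute value then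
`|x − z|₂ ≤ √d·(L − 1)`** (integer coordinates). [folklore] [cite: BenfattoEtAl1978, §5 (5.7) p.154 (class form)] -/
theorem l2_le_sqrt_mul_of_abs_lt {L : ℕ} {x z : B1Eq324BenfattoLemma.Site d} (h : ∀ i, |x i - z i| < (L : ℤ)) :
    Real.sqrt (∑ j, (((x j : ℝ) - (z j : ℝ))) ^ 2) ≤ Real.sqrt d * ((L : ℝ) - 1) := by
  rcases Nat.eq_zero_or_pos d with hd | hd
  · subst hd
    simp
  · have hL1 : ∀ i, |((x i : ℝ) - (z i : ℝ))| ≤ (L : ℝ) - 1 := fun i => by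
      have hi : |x i - z i| ≤ (L : ℤ) - 1 := Int.le_sub_one_of_lt (h i)
      have hi' : ((|x i - z i| : ℤ) : ℝ) ≤ (((L : ℤ) - 1 : ℤ) : ℝ) := by exact_mod_cast hi
      simpa [Int.cast_abs, Int.cast_sub] using hi'
    have hL0 : 0 ≤ (L : ℝ) - 1 := (abs_nonneg _).trans (hL1 ⟨0, hd⟩)
    have hsum : ∑ j, (((x j : ℝ) - (z j : ℝ))) ^ 2 ≤ (d : ℝ) * ((L : ℝ) - 1) ^ 2 := by
      calc ∑ j, (((x j : ℝ) - (z j : ℝ))) ^ 2 ≤ ∑ _j : Fin d, ((L : ℝ) - 1) ^ 2 :=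
            Finset.sum_le_sum fun j _ => by
              rw [← sq_abs]
              exact pow_le_pow_left₀ (abs_nonneg _) (hL1 j) 2
        _ = (d : ℝ) * ((L : ℝ) - 1) ^ 2 := by simp
    calc Real.sqrt (∑ j, (((x j : ℝ) - (z j : ℝ))) ^ 2) ≤ Real.sqrt ((d : ℝ) * ((L : ℝ) - 1) ^ 2) := Real.sqrt_le_sqrt hsum
      _ = Real.sqrt d * ((L : ℝ) - 1) := by rw [Real.sqrt_mul (Nat.cast_nonneg d), Real.sqrt_sq hL0]

/-- ★★ **THE CONDITIONING SETS MISS THE PARTS** — if `C_0` is Euclidean-far from `J_0` in the original frame, `|x − c|₂ ≥ R + √d·L` (`R > 0`), then at every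
step every part `shrink L m w ⊆ □_m`, `□_m ∈ B_k`, is disjoint from `C_k + τ_k`: the (4.6) knit's binder `hCsh` (print: «C … at distance b³ from J»; a part point
read back in the original frame is within `√d(L−1)` of `J_0`, a conditioning point IS a point of `C_0`).
[cite: BenfattoEtAl1978, Lemma p.152 «at distance b³ from J», §5 (5.36) p.159 (class form; ours)] -/
theorem disjoint_shrink_conditioning_of_far (hL : 0 < L)
    (hrecJ : ∀ k < n, Js (k + 1) = (Js k).image (fun x => x + τ k) ∩ corridorsBar L w v (Bs k))
    (hrecC : ∀ k < n, Cs (k + 1) = (Cs k).image fun x => x + τ k)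
    (hσ0 : σ 0 = 0) (hrecσ : ∀ k < n, σ (k + 1) = σ k - τ k) {R : ℝ} (hR : 0 < R)
    (hCfar0 : ∀ c ∈ Cs 0, ∀ x ∈ Js 0, R + Real.sqrt d * (L : ℝ) ≤ Real.sqrt (∑ j, (((x j : ℝ) - (c j : ℝ))) ^ 2)) :
    ∀ k, k < n → ∀ m ∈ ((Js k).image fun x => x + τ k).image (boxIndex L), Disjoint (shrink L m w) ((Cs k).image fun x => x + τ k) := by
  intro k hk m hm
  rw [conditioning_image_add_eq hrecC hσ0 hrecσ k hk, Finset.disjoint_left]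
  intro z hz hzC
  obtain ⟨c, hc, hcz⟩ := Finset.mem_image.mp hzC
  obtain ⟨p, hp, rfl⟩ := Finset.mem_image.mp hm
  obtain ⟨y, hy, rfl⟩ := Finset.mem_image.mp hp
  have hyJ : y + σ k ∈ Js 0 := image_add_sigma_mem hrecJ hσ0 hrecσ k hk.le y hy
  -- `z + σ_{k+1} = c ∈ C_0` is within `√d(L−1)` of `y + σ_k ∈ J_0`
  have hzbox := shrink_subset_box L _ w hz
  have hclose : ∀ i, |(y + σ k) i - c i| < (L : ℤ) := fun i => by
    have hz' := (mem_box_iff.mp hzbox) i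
    have hy' := (mem_box_iff.mp (mem_box_boxIndex hL (y + τ k))) i
    have hc' : c i = z i + σ (k + 1) i := by
      have := congrArg (fun f => f i) hcz
      simp only [Pi.sub_apply] at this
      linarith
    rw [hrecσ k hk] at hc'
    simp only [Pi.add_apply, Pi.sub_apply] at hz' hy' hc' ⊢
    rw [abs_lt]
    constructor <;> linarith
  have h1 := l2_le_sqrt_mul_of_abs_lt hclose
  have h2 := hCfar0 c hc (y + σ k) hyJ
  have h3 : Real.sqrt d * ((L : ℝ) - 1) < R + Real.sqrt d * (L : ℝ) := by
    have : 0 ≤ Real.sqrt d := Real.sqrt_nonneg d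
    nlinarith
  linarith

/-- ★★ **THE CONDITIONING SETS ARE FAR FROM THE BOXES** — under the same original-frame hypothesis, at every step every point of a tessera `□_m`, `□_m ∈ B_k`,
is `|·−·|₂ ≥ R` from `C_k + τ_k`: the (4.6) knit's binder `hCfar` (triangle inequality: `|x − c|₂ ≥ |j − c|₂ − |j − x|₂ ≥ (R + √d L) − √d(L−1)`).
[cite: BenfattoEtAl1978, Lemma p.152 «at distance b³ from J», §5 (5.30)–(5.31) p.158 (class form; ours)] -/
theorem far_conditioning_of_far (hL : 0 < L)
    (hrecJ : ∀ k < n, Js (k + 1) = (Js k).image (fun x => x + τ k) ∩ corridorsBar L w v (Bs k))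
    (hrecC : ∀ k < n, Cs (k + 1) = (Cs k).image fun x => x + τ k)
    (hσ0 : σ 0 = 0) (hrecσ : ∀ k < n, σ (k + 1) = σ k - τ k) {R : ℝ}
    (hCfar0 : ∀ c ∈ Cs 0, ∀ x ∈ Js 0, R + Real.sqrt d * (L : ℝ) ≤ Real.sqrt (∑ j, (((x j : ℝ) - (c j : ℝ))) ^ 2)) :
    ∀ k, k < n → ∀ m ∈ ((Js k).image fun x => x + τ k).image (boxIndex L), ∀ x ∈ box L m, ∀ c ∈ (Cs k).image (fun x => x + τ k),
      R ≤ Real.sqrt (∑ j, (((x j : ℝ) - (c j : ℝ))) ^ 2) := by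
  intro k hk m hm x hx c' hc'
  rw [conditioning_image_add_eq hrecC hσ0 hrecσ k hk] at hc'
  obtain ⟨c, hc, rfl⟩ := Finset.mem_image.mp hc'
  obtain ⟨p, hp, rfl⟩ := Finset.mem_image.mp hm
  obtain ⟨y, hy, rfl⟩ := Finset.mem_image.mp hp
  have hyJ : y + σ k ∈ Js 0 := image_add_sigma_mem hrecJ hσ0 hrecσ k hk.le y hy
  -- in the original frame: `x + σ_{k+1}` is within `√d(L−1)` of `y + σ_k ∈ J_0`, and `c ∈ C_0`
  have hclose : ∀ i, |(y + σ k) i - (x + σ (k + 1)) i| < (L : ℤ) := fun i => by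
    have hx' := (mem_box_iff.mp hx) i
    have hy' := (mem_box_iff.mp (mem_box_boxIndex hL (y + τ k))) i
    rw [hrecσ k hk]
    simp only [Pi.add_apply, Pi.sub_apply] at hx' hy' ⊢
    rw [abs_lt]
    constructor <;> linarith
  have h1 := l2_le_sqrt_mul_of_abs_lt hclose
  have h2 := hCfar0 c hc (y + σ k) hyJ
  have h3 := l2_triangle (y + σ k) (x + σ (k + 1)) c
  -- `|x − (c − σ_{k+1})|₂ = |(x + σ_{k+1}) − c|₂`
  have h4 : Real.sqrt (∑ j, (((x j : ℝ) - ((c - σ (k + 1)) j : ℝ))) ^ 2) = Real.sqrt (∑ j, ((((x + σ (k + 1)) j : ℝ) - (c j : ℝ))) ^ 2) := by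
    congr 1
    refine Finset.sum_congr rfl fun j _ => ?_
    simp only [Pi.sub_apply, Pi.add_apply, Int.cast_sub, Int.cast_add]
    ring
  rw [h4]
  have h5 : 0 ≤ Real.sqrt d := Real.sqrt_nonneg d
  nlinarith

end Conditioning

/-! ## §4  The separation binder for the constant diagonal displacements -/

section Shifts

/-- **`hsep` FOR THE CONSTANT DIAGONAL DISPLACEMENTS** `τ_k ≡ −c·𝟙`: the cumulative displacements `−Σ_{i'≤j} τ_{i'} = (j+1)·c·𝟙` are pairwise `c`-separated
modulo `L` in every coordinate as soon as `(d+1)·c ≤ L` — the binder of `…Sect5PavementChain.chain_eq_empty_of_sep` / n08-d's `exists_stoppingIndex` VERBATIM,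
from `sep_of_diagonalShifts`. [cite: BenfattoEtAl1978, §5 p.154 «we can arrange the pavements», p.159 (class form)] -/
theorem sep_of_constDiagonal {L c : ℕ} (hfit : (d + 1) * c ≤ L) :
    ∀ j j' : Fin (d + 1), j ≠ j' → ∀ (i : Fin d) (q : ℤ),
      (c : ℤ) ≤ |(-(∑ i' ∈ Finset.range ((j : ℕ) + 1), (fun (_ : ℕ) (_ : Fin d) => -(c : ℤ)) i')) i -
        (-(∑ i' ∈ Finset.range ((j' : ℕ) + 1), (fun (_ : ℕ) (_ : Fin d) => -(c : ℤ)) i')) i - q * L| := by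
  intro j j' hjj' i q
  have h := sep_of_diagonalShifts (d := d) hfit j j' hjj' i q
  have e : ∀ m : ℕ, (-(∑ i' ∈ Finset.range (m + 1), (fun (_ : ℕ) (_ : Fin d) => -(c : ℤ)) i')) i = ((m : ℕ) + 1 : ℤ) * c := fun m => by
    rw [Pi.neg_apply, Finset.sum_apply]
    simp only [Finset.sum_const, Finset.card_range, smul_neg, nsmul_eq_mul, neg_neg]
    push_cast
    ring
  rw [e, e]
  exact h

end Shifts

end Literature.MathematicalPhysics.QuantumFieldTheory.Balaban1983to89.B1Eq324BenfattoKernelSect5ChainGeometry
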